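import Summits.Ventures.PercRepro.S2QuartGiantCount

/-!
# PercRepro — S2: THE GIANT-EXACT COUNT, PART 1 — the level lemmas: the non-giant sets by the small and mid pairs, the giant
sets of every level inside the unique giant flat (p8, gen 18; a feeder for S4 — the top of the `q = 7` window)

In the giant count `ncard_eRk_eq_ncard_le_le_giant_quart'` (p4 g17 on p8's unique-giant-flat split) the rank-`q` sets whose
closure is the giant flat `F_g` (`|F_g| ≥ q + ν₁`; unique by `closure_eq_of_giant`) are counted through the pairs inside
`F_g` with the fibre weight `1/quart(ν)`: at corank `d ≈ p` this term is `≈ 10^5` times the number of SUBSETS of `F_g`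
(level `7`, `d = 71`: `≈ 2·10^27` at `ν = 36` against `C(78, 43) ≈ 4·10^22`) and alone exceeds the budget of the cell. Here the
giant sets are counted by the powerset of `F_g` instead — `≤ 2^{|F_g|} ≤ 2^{min f (q + d)}` — and the non-giant sets exactly
as before (the small and mid pairs, the mid weight on all of them):
`#{B ⊆ E : r(B) = q, |B| ≤ d} ≤ C(n, q) + σ_m·P_E + 2^{min f (q + d)}`.
* **`levelFNonGiant` / `levelFGiant`** — the level-`m` sets split by the size of their closure (`≤ f′ + 1`, or `< q + ν₁`:
  non-giant; else giant); `closure_eq_closure_of_fibre` — a set has the closure of every pair in its fibre;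
* **`mul_card_levelFNonGiant_le`** — the level-`m` double count restricted to the non-giant sets: every pair in the fibre
  of a non-giant set is a small or a mid pair;
* **`sum_card_levelFGiant_le`** — the giant sets of every level are subsets of ONE rank-`q` flat of `≤ min f (q + d)` points;
The count itself (`ncard_eRk_eq_ncard_le_le_giant_exact`) is Part 2 (S2GiantExactCount). Level-generic. Axioms: standard.
-/

open scoped Matroid

namespace PercRepro

namespace S2

open Set Finset

variable {α : Type} {M : Matroid α}

open scoped Classical in
/-- The level-`m` rank-`q` sets whose closure is NOT giant (`≤ f′ + 1` points, or fewer than `q + ν₁`). -/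
noncomputable def levelFNonGiant (M : Matroid α) [M.Finite] (q f' ν₁ m : ℕ) : Finset (Finset α) :=
  (Matroid.levelF M q m).filter
    (fun B => (M.closure (B : Set α)).ncard ≤ f' + 1 ∨ ¬ q + ν₁ ≤ (M.closure (B : Set α)).ncard)

open scoped Classical in
/-- The level-`m` rank-`q` sets whose closure IS giant (more than `f′ + 1` and at least `q + ν₁` points). -/
noncomputable def levelFGiant (M : Matroid α) [M.Finite] (q f' ν₁ m : ℕ) : Finset (Finset α) :=
  (Matroid.levelF M q m).filter
    (fun B => ¬ ((M.closure (B : Set α)).ncard ≤ f' + 1 ∨ ¬ q + ν₁ ≤ (M.closure (B : Set α)).ncard))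

open scoped Classical in
/-- The level-`m` sets are the non-giant ones and the giant ones. -/
theorem card_levelF_eq_nonGiant_add_giant [M.Finite] (q f' ν₁ m : ℕ) :
    (Matroid.levelF M q m).card = (levelFNonGiant M q f' ν₁ m).card + (levelFGiant M q f' ν₁ m).card := by
  unfold levelFNonGiant levelFGiant
  exact (Finset.card_filter_add_card_filter_not _).symm

/-- A set has the closure of every pair in its fibre: `C ∪ B′ ⊆ B ⊆ cl(C ∪ B′)` gives `cl(B) = cl(C ∪ B′)`. -/
theorem closure_eq_closure_of_fibre {U B : Set α} (hUB : U ⊆ B) (hBcl : B ⊆ M.closure U) :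
    M.closure B = M.closure U := by
  apply le_antisymm
  · calc M.closure B ⊆ M.closure (M.closure U) := M.closure_subset_closure hBcl
      _ = M.closure U := M.closure_closure U
  · exact M.closure_subset_closure hUB

open scoped Classical in
/-- **The level-`m` double count restricted to the non-giant sets**: every pair in the fibre of a non-giant set is a
small or a mid pair, so `quart(m − q)·#levelFNonGiant ≤ Ps·C(f′ − q, m − q − 1) + Pm·C(min(f − q − 1, ν₁ − 2), m − q − 1)`. -/
theorem mul_card_levelFNonGiant_le [M.Finite] (q f f' ν₁ : ℕ) (hq : 1 ≤ q)
    (hcirc : ∀ C, M.IsCircuit C → 3 ≤ C.encard) (hC1 : ∀ L ⊆ M.E, M.eRk L = 2 → L.ncard ≤ 3)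
    (hC2 : ∀ L ⊆ M.E, M.eRk L ≤ 3 → L.ncard ≤ 6)
    (hflat : ∀ X ⊆ M.E, M.eRk X ≤ q → X.ncard ≤ f) (m : ℕ) :
    ((m - q) + 3 * (m - q).choose 2 + 3 * (m - q).choose 3 + 2 * (m - q).choose 4) * (levelFNonGiant M q f' ν₁ m).card ≤
      (Matroid.pairsSmall M q f').card * (f' - q).choose (m - (q + 1)) +
        (Matroid.pairsMid M q f' ν₁).card * (min (f - (q + 1)) (ν₁ - 2)).choose (m - (q + 1)) := by
  -- the non-giant pairs
  set NG : Set α × Set α → Prop :=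
    fun p => (M.closure (p.1 ∪ p.2)).ncard ≤ f' + 1 ∨ ¬ q + ν₁ ≤ (M.closure (p.1 ∪ p.2)).ncard with hNG
  set pairsNG := (Matroid.pairsF M q).filter NG with hpairsNG
  have hsmall : pairsNG.filter (fun p => (M.closure (p.1 ∪ p.2)).ncard ≤ f' + 1) = Matroid.pairsSmall M q f' := by
    ext p
    simp only [hpairsNG, Matroid.pairsSmall, Finset.mem_filter, hNG]
    tauto
  have hmid : pairsNG.filter (fun p => ¬ (M.closure (p.1 ∪ p.2)).ncard ≤ f' + 1) = Matroid.pairsMid M q f' ν₁ := by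
    ext p
    simp only [hpairsNG, Matroid.pairsMid, Matroid.pairsBig, Finset.mem_filter, hNG]
    tauto
  -- the double count over the non-giant pairs
  have hcomm : ∑ p ∈ pairsNG, (Matroid.fibreLevel M q p m).card =
      ∑ B ∈ Matroid.levelF M q m, (pairsNG.filter (fun p => p.1 ∪ p.2 ⊆ (B : Set α) ∧
        (B : Set α) ⊆ M.closure (p.1 ∪ p.2))).card := by
    unfold Matroid.fibreLevel
    simp only [Finset.card_filter]
    exact Finset.sum_comm
  have hsub : levelFNonGiant M q f' ν₁ m ⊆ Matroid.levelF M q m := Finset.filter_subset _ _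
  have hfib : ∀ B ∈ levelFNonGiant M q f' ν₁ m,
      ((m - q) + 3 * (m - q).choose 2 + 3 * (m - q).choose 3 + 2 * (m - q).choose 4) ≤
        (pairsNG.filter (fun p => p.1 ∪ p.2 ⊆ (B : Set α) ∧ (B : Set α) ⊆ M.closure (p.1 ∪ p.2))).card := by
    intro B hB
    unfold levelFNonGiant at hB
    rw [Finset.mem_filter] at hB
    obtain ⟨hBl, hBng⟩ := hB
    obtain ⟨hBg, hBm, hBq⟩ := Matroid.mem_levelF.1 hBl
    have hBE : (B : Set α) ⊆ M.E := by rw [← Matroid.coe_groundF]; exact_mod_cast hBg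
    have hmult := card_pairs_ge_quart q hq hcirc hC1 hC2 hBE hBq
    rw [hBm] at hmult
    refine hmult.trans (le_of_eq ?_)
    congr 1
    rw [hpairsNG, Finset.filter_filter]
    apply Finset.filter_congr
    intro p _
    constructor
    · intro h
      refine ⟨?_, h⟩
      show (M.closure (p.1 ∪ p.2)).ncard ≤ f' + 1 ∨ ¬ q + ν₁ ≤ (M.closure (p.1 ∪ p.2)).ncard
      rw [← closure_eq_closure_of_fibre h.1 h.2]
      exact hBng
    · intro h; exact h.2
  calc ((m - q) + 3 * (m - q).choose 2 + 3 * (m - q).choose 3 + 2 * (m - q).choose 4) * (levelFNonGiant M q f' ν₁ m).card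
      = ∑ _B ∈ levelFNonGiant M q f' ν₁ m, ((m - q) + 3 * (m - q).choose 2 + 3 * (m - q).choose 3 + 2 * (m - q).choose 4) := by
        simp [mul_comm]
    _ ≤ ∑ B ∈ levelFNonGiant M q f' ν₁ m, (pairsNG.filter (fun p => p.1 ∪ p.2 ⊆ (B : Set α) ∧
          (B : Set α) ⊆ M.closure (p.1 ∪ p.2))).card := Finset.sum_le_sum hfib
    _ ≤ ∑ B ∈ Matroid.levelF M q m, (pairsNG.filter (fun p => p.1 ∪ p.2 ⊆ (B : Set α) ∧
          (B : Set α) ⊆ M.closure (p.1 ∪ p.2))).card :=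
        Finset.sum_le_sum_of_subset_of_nonneg hsub (fun _ _ _ => Nat.zero_le _)
    _ = ∑ p ∈ pairsNG, (Matroid.fibreLevel M q p m).card := hcomm.symm
    _ = ∑ p ∈ Matroid.pairsSmall M q f', (Matroid.fibreLevel M q p m).card +
          ∑ p ∈ Matroid.pairsMid M q f' ν₁, (Matroid.fibreLevel M q p m).card := by
        rw [← hsmall, ← hmid]
        exact (Finset.sum_filter_add_sum_filter_not pairsNG _ _).symm
    _ ≤ ∑ _p ∈ Matroid.pairsSmall M q f', (f' - q).choose (m - (q + 1)) +
          ∑ _p ∈ Matroid.pairsMid M q f' ν₁, (min (f - (q + 1)) (ν₁ - 2)).choose (m - (q + 1)) := by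
        gcongr with p hp p hp
        · exact Matroid.card_fibreLevel_small q f' hp m
        · exact Matroid.card_fibreLevel_mid q f f' ν₁ hflat hp m
    _ = _ := by simp only [Finset.sum_const, smul_eq_mul]

/-- `Σ_{m ∈ Icc a b} C(N, m) ≤ 2^N`. -/
theorem sum_Icc_choose_le_two_pow (N a b : ℕ) : ∑ m ∈ Finset.Icc a b, N.choose m ≤ 2 ^ N := by
  calc ∑ m ∈ Finset.Icc a b, N.choose m ≤ ∑ m ∈ Finset.range (N + b + 1), N.choose m := by
        apply Finset.sum_le_sum_of_subset_of_nonneg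
        · intro m hm
          rw [Finset.mem_Icc] at hm
          rw [Finset.mem_range]
          omega
        · intro _ _ _; exact Nat.zero_le _
    _ = ∑ m ∈ Finset.range (N + 1), N.choose m + ∑ m ∈ Finset.Ico (N + 1) (N + b + 1), N.choose m := by
        rw [Finset.sum_range_add_sum_Ico _ (by omega)]
    _ = 2 ^ N + 0 := by
        rw [Nat.sum_range_choose]
        congr 1
        apply Finset.sum_eq_zero
        intro m hm
        rw [Finset.mem_Ico] at hm
        exact Nat.choose_eq_zero_of_lt (by omega)
    _ = 2 ^ N := by ring

open scoped Classical in
/-- **The giant sets of all levels lie in ONE flat**: the closures of the giant sets coincide (`closure_eq_of_giant` on a pair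
of each fibre), that flat has rank `q` and at most `min f (q + d)` points, so the giant sets of all levels number at most
`2^{min f (q + d)}`. -/
theorem sum_card_levelFGiant_le [M.Finite] (q f f' ν₁ νi : ℕ) (hq : 1 ≤ q)
    (hcirc : ∀ C, M.IsCircuit C → 3 ≤ C.encard) (hC1 : ∀ L ⊆ M.E, M.eRk L = 2 → L.ncard ≤ 3)
    (hC2 : ∀ L ⊆ M.E, M.eRk L ≤ 3 → L.ncard ≤ 6)
    (hflat : ∀ X ⊆ M.E, M.eRk X ≤ q → X.ncard ≤ f)
    (hflat' : ∀ X ⊆ M.E, M.eRk X ≤ (q - 1 : ℕ) → X.ncard ≤ f')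
    (hinter : ∀ X ⊆ M.E, M.eRk X ≤ (q - 1 : ℕ) → (X.ncard : ℕ∞) ≤ M.eRk X + νi)
    {d : ℕ} (hd : M.E.encard = M.eRank + d) (h2 : d + νi < 2 * ν₁) :
    ∑ m ∈ Finset.Icc (q + 1) d, (levelFGiant M q f' ν₁ m).card ≤ 2 ^ (min f (q + d)) := by
  -- a giant set has a giant pair in its fibre
  have hpair : ∀ m ∈ Finset.Icc (q + 1) d, ∀ B ∈ levelFGiant M q f' ν₁ m,
      ∃ p ∈ Matroid.pairsGiant M q f' ν₁, M.closure (B : Set α) = M.closure (p.1 ∪ p.2) := by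
    intro m hm B hB
    rw [Finset.mem_Icc] at hm
    unfold levelFGiant at hB
    rw [Finset.mem_filter] at hB
    obtain ⟨hBl, hBg⟩ := hB
    push Not at hBg
    obtain ⟨hBgr, hBm, hBq⟩ := Matroid.mem_levelF.1 hBl
    have hBE : (B : Set α) ⊆ M.E := by rw [← Matroid.coe_groundF]; exact_mod_cast hBgr
    have hmult := card_pairs_ge_quart q hq hcirc hC1 hC2 hBE hBq
    rw [hBm] at hmult
    have hpos : 0 < ((Matroid.pairsF M q).filter (fun p => p.1 ∪ p.2 ⊆ (B : Set α) ∧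
        (B : Set α) ⊆ M.closure (p.1 ∪ p.2))).card := by
      have : 0 < (m - q) + 3 * (m - q).choose 2 + 3 * (m - q).choose 3 + 2 * (m - q).choose 4 := by
        have : 1 ≤ m - q := by omega
        omega
      omega
    obtain ⟨p, hp⟩ := Finset.card_pos.1 hpos
    rw [Finset.mem_filter] at hp
    obtain ⟨hpF, hpB, hBp⟩ := hp
    have hcl : M.closure (B : Set α) = M.closure (p.1 ∪ p.2) := closure_eq_closure_of_fibre hpB hBp
    refine ⟨p, ?_, hcl⟩
    unfold Matroid.pairsGiant Matroid.pairsBig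
    rw [Finset.mem_filter, Finset.mem_filter]
    rw [← hcl]
    exact ⟨⟨hpF, not_le.2 hBg.1⟩, hBg.2⟩
  by_cases hex : ∃ m ∈ Finset.Icc (q + 1) d, ∃ B, B ∈ levelFGiant M q f' ν₁ m
  · obtain ⟨m₀, hm₀, B₀, hB₀⟩ := hex
    obtain ⟨p₀, hp₀, hcl₀⟩ := hpair m₀ hm₀ B₀ hB₀
    -- the giant flat
    set Fg := M.closure (B₀ : Set α) with hFg
    have hFgE : Fg ⊆ M.E := M.closure_subset_ground _
    have hFgfin : Fg.Finite := M.ground_finite.subset hFgE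
    have hB₀q : M.eRk (B₀ : Set α) = (q : ℕ∞) := by
      unfold levelFGiant at hB₀
      rw [Finset.mem_filter] at hB₀
      exact (Matroid.mem_levelF.1 hB₀.1).2.2
    have hFgrk : M.eRk Fg = (q : ℕ∞) := by rw [hFg, M.eRk_closure_eq, hB₀q]
    have hFgf : Fg.ncard ≤ f := hflat Fg hFgE (by rw [hFgrk])
    have hFgd : Fg.ncard ≤ q + d := by
      have h := Matroid.encard_le_eRk_add_of_encard_eq hFgE hd
      rw [hFgrk, ← hFgfin.cast_ncard_eq] at h
      exact_mod_cast h
    have hFgmin : Fg.ncard ≤ min f (q + d) := le_min hFgf hFgd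
    -- every giant set of every level lies in the giant flat
    have hin : ∀ m ∈ Finset.Icc (q + 1) d, ∀ B ∈ levelFGiant M q f' ν₁ m, B ⊆ hFgfin.toFinset := by
      intro m hm B hB
      obtain ⟨p, hp, hcl⟩ := hpair m hm B hB
      have hBE : (B : Set α) ⊆ M.E := by
        unfold levelFGiant at hB
        rw [Finset.mem_filter] at hB
        rw [← Matroid.coe_groundF]
        exact_mod_cast (Matroid.mem_levelF.1 hB.1).1
      have heq : M.closure (p.1 ∪ p.2) = M.closure (p₀.1 ∪ p₀.2) :=
        Matroid.closure_eq_of_giant hq hflat' hinter hd h2 hp hp₀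
      have hBF : (B : Set α) ⊆ Fg := by
        calc (B : Set α) ⊆ M.closure (B : Set α) := M.subset_closure _ hBE
          _ = Fg := by rw [hcl, heq, ← hcl₀]
      intro x hx
      rw [Set.Finite.mem_toFinset]
      exact hBF hx
    have hlev : ∀ m ∈ Finset.Icc (q + 1) d, (levelFGiant M q f' ν₁ m).card ≤ Fg.ncard.choose m := by
      intro m hm
      have hsub : levelFGiant M q f' ν₁ m ⊆ hFgfin.toFinset.powersetCard m := by
        intro B hB
        rw [Finset.mem_powersetCard]
        refine ⟨hin m hm B hB, ?_⟩
        unfold levelFGiant at hB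
        rw [Finset.mem_filter] at hB
        exact (Matroid.mem_levelF.1 hB.1).2.1
      calc (levelFGiant M q f' ν₁ m).card ≤ (hFgfin.toFinset.powersetCard m).card := Finset.card_le_card hsub
        _ = hFgfin.toFinset.card.choose m := Finset.card_powersetCard _ _
        _ = Fg.ncard.choose m := by rw [Set.ncard_eq_toFinset_card _ hFgfin]
    calc ∑ m ∈ Finset.Icc (q + 1) d, (levelFGiant M q f' ν₁ m).card
        ≤ ∑ m ∈ Finset.Icc (q + 1) d, Fg.ncard.choose m := Finset.sum_le_sum hlev
      _ ≤ 2 ^ Fg.ncard := sum_Icc_choose_le_two_pow _ _ _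
      _ ≤ 2 ^ (min f (q + d)) := Nat.pow_le_pow_right (by norm_num) hFgmin
  · push Not at hex
    have hzero : ∀ m ∈ Finset.Icc (q + 1) d, (levelFGiant M q f' ν₁ m).card = 0 := by
      intro m hm
      rw [Finset.card_eq_zero]
      exact Finset.eq_empty_of_forall_notMem (hex m hm)
    rw [Finset.sum_eq_zero hzero]
    exact Nat.zero_le _

end S2

end PercRepro
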